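import Summits.QuantumFields.YangMills.Theorems.LuscherReductionTwistedTraceScalingValleyBOUpperPow
import HarnessLib

/-!
# R13 (crux `TwistedTraceScaling`, stmt-QuantumFields-20203): the k = 0 FLOOR with lane B's normalisation,
# `ValleyFloorAt L (β^{−p}) (1/2) N_B`, is FALSE unless `3r > 1 + 3m` (every `L ≥ 1`, every `q`), and at `L = 1` unless moreover
# `m > 2p` and `3r > 1 + 3m + p` — the untyped exponent ledger of lane A's C3 design of record is NECESSARY, and
# `coarseNoIntruderAt_of_floor_pow` is VACUOUS on `3r ≤ 1 + 3m`

Standing disprover `ym-cdisprove-20203-1` (gen 12).  Lane A's state of record (p588972 `…ValleyBOUpper`, p589698 `…ValleyBOUpperPow`) is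
"C3 ⇐ FLOOR(N_B) + INNER": `coarseNoIntruderAt_of_floor_pow` takes as typed input
`hF : ValleyFloorAt L (powScale p) (1/2) (fun β => riccatiN L β (powScale r β) (2 * powScale q β) (powScale m β))`, i.e. eventually
`N_B(β)·e^{−6Z₀(L)}·e^{−εβ^{−p}} ≤ λ₀(β, L)` for every `ε > 0`, where `N_B = riccatiPref·riccatiGauss` carries lane B's error exponents
`e^{(β/2)(η₁+θ)}·e^{trialErr}·e^{3|E|·modeZPE((β/2)μ/b')}` on top of the free Gaussian constant, under the typed constraints `0 < p < 1/3`, `4p < q < 8/9`,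
`0 < r < 1/2`, `0 < m`, `2r < q − m/2` only.  This file attacks that input with TREE facts alone (no spectral theory):
* `levelValue_zero_le_gauss` — the Schur–Gauss CEILING `λ₀ ≤ c_β^{|E|} ≤ N_free(β) := (e^{2β}√(π/β)³/(2π²))^{|E|}` (`topValue_le_latCE`, `linkC_le_gauss`);
* `trialErr_ge` — the Lipschitz term of lane B's error budget alone gives `trialErr ≥ 100800000·ρ³N³√n·Lc`;
* `riccatiN_ge` — `N_B ≥ N_free·e^{trialErr}·e^{3|E|·modeZPE((β/2)μ/b')}`;
* `modeZPE_ge` — `modeZPE y ≥ √(2y)/4` on `[0, 1/2]`; `toronZPE_one` — `Z₀(1) = 0` at every mass (the `1³` torus has only the zero mode);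
* ★ `valleyFloorAt_riccatiN_false (hp : 0 ≤ p) (hr : 0 ≤ r) (h : 3r < 1 + 3m)` — FLOOR(N_B) is FALSE at every `L ≥ 1`, every `q`, every real `m`:
  FLOOR(ε = 1) and the ceiling force `trialErr ≤ 6Z₀(L) + 1` eventually, while `trialErr ≥ β^{1+3m−3r} → ∞`
  (`Lc ≥ 3b'/μ³ ≥ (3/4)β^{1+3m}`, `ρ³ = β^{−3r}`);
* ★ `valleyFloorAt_riccatiN_one_false (hr : 0 ≤ r) (hm : 0 ≤ m) (h : m ≤ 2p ∨ 3r ≤ 1 + 3m + p)` — at `L = 1` (`Z₀ = 0`) FLOOR(ε = 1) forces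
  `trialErr + 9·modeZPE(μ(1+ρ²)²/2) ≤ β^{−p}`, killed by `9·modeZPE ≥ (9/4)β^{−m/2}` when `m ≤ 2p` and by `trialErr ≥ β^{−p}` when `3r ≤ 1 + 3m + p`;
* `floor_ledger_window` — consequently lane A's typed constraints plus the necessary `1 + 3m < 3r` force `q > 2/3 + 5m/2`, `r > 1/3`, `m < 1/6`
  (pure arithmetic; this is the typed shadow of the untyped ledger "q > 2/3 + 17p/3" of COARSE-DESIGN §17.7), and the recommended point
  `(p, q, r, m) = (1/40, 0.85, 0.41, 0.055)` passes all three necessary conditions (`3r = 1.23 > 1.165 + 0.025`, `m = 0.055 > 0.05`).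
READING.  `coarseNoIntruderAt_of_floor_pow` is vacuous (its `hF` is unsatisfiable) on the sub-range `3r ≤ 1 + 3m` of its own typed hypotheses
(e.g. `(p, q, r, m) = (1/40, 0.85, 0.35, 0.055)` satisfies `0 < r`, `2r < 1`, `2r < q − m/2` and is killed); the FLOOR it wants is a statement about
`λ₀` at precision `e^{o(β^{−p})}` relative to `N_free e^{−6Z₀}`, so every error exponent lane B loads into `N_B` must itself be `o(β^{−p})` — at `L = 1`
this is checkable against the ceiling and gives `m > 2p`, `3r > 1 + 3m + p`; at `L ≥ 2` only the divergent part (`3r ≤ 1 + 3m`) is visible to the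
free ceiling (a kill at lane A's point would need the semiclassical upper bound `λ₀ ≤ N_free e^{−6Z₀ + o(β^{−p})}`, which is lane A's own INNER/UPPER
programme).  NO KILL of the crux and no kill of FLOOR(N_B) at the point of record.
HONEST FRAMING: fixed-lattice `SU(2)` bookkeeping about a typed input of a stub (S-BASE C3) of a child of the CONDITIONAL reduction route (femto rung
R2b1); `ValleyFloorAt … N_B` at lane A's exponents, `InnerNoIntruderOneOrbitAt`, C3/C4 stay OPEN; not `¬TwistedTraceScaling`, not infinite volume,
not a gap, not Clay.  Sorry-free, no new definition; axioms ⊆ {propext, Classical.choice, Quot.sound}.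
-/

set_option autoImplicit false

noncomputable section

open Filter Real
open Literature.MathematicalPhysics.QuantumFieldTheory
open Literature.MathematicalPhysics.QuantumLattice
open Summit.QuantumFields.YangMills.Theorems.FemtoTransferGap
open Summit.QuantumFields.YangMills.Theorems.FemtoTransferGap.TwoLattice
open Summit.QuantumFields.YangMills.Theorems.FemtoTransferGap.TwoLattice.Toron
open Summit.QuantumFields.YangMills.Theorems.FemtoTransferGap.TwoLattice.Cov

namespace Summit.QuantumFields.YangMills.Theorems.TwistedTraceScaling.Negative.R13

/-! ## §1 The free Gaussian ceiling on `λ₀` and the size of lane B's `N_B` -/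

/-- **Schur–Gauss ceiling**: `λ₀(β, L) ≤ N_free(β) := (e^{2β}√(π/β)³/(2π²))^{|E|}` for every `β > 0`
(`λ₀ ≤ c_β^{|E|}` and `c_β ≤ e^{2β}√(π/β)³/(2π²)`). [cite: MontvayMunster1994, §3.2.3 (3.97) p.121] -/
theorem levelValue_zero_le_gauss (L : ℕ) [NeZero L] {β : ℝ} (hβ : 0 < β) :
    levelValue su2Rep L β 0 ≤ (Real.exp (2 * β) * Real.sqrt (π / β) ^ 3 / (2 * π ^ 2)) ^ Fintype.card (Edge 3 L) := by
  rw [levelValue_zero]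
  refine (topValue_le_latCE hβ.le).trans ?_
  unfold latCE
  exact pow_le_pow_left₀ (linkC_pos hβ.le).le (linkC_le_gauss hβ) _

/-- **The Lipschitz term of lane B's error budget alone**: `trialErr ρ σ N n m m₁ Lc ≥ 100800000·ρ³·N³·√n·Lc` for `ρ, N, m, m₁, Lc ≥ 0`
(`504ρ√N·20√N·(Lc√n·100N)·(10ρ√N)²`, all dropped terms nonnegative). [cite: Luscher1983, §3] -/
theorem trialErr_ge {ρ σ N n m m₁ Lc : ℝ} (hρ : 0 ≤ ρ) (hN : 0 ≤ N) (hm : 0 ≤ m) (hm₁ : 0 ≤ m₁) (hL : 0 ≤ Lc) :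
    100800000 * ρ ^ 3 * N ^ 3 * Real.sqrt n * Lc ≤ trialErr ρ σ N n m m₁ Lc := by
  unfold trialErr
  have hsN : 0 ≤ Real.sqrt N := Real.sqrt_nonneg _
  have hsn : 0 ≤ Real.sqrt n := Real.sqrt_nonneg _
  have hsσ : 0 ≤ Real.sqrt σ := Real.sqrt_nonneg _
  have hrem : 0 ≤ stepRem ρ σ := stepRem_nonneg' σ hρ
  have hN3 : Real.sqrt N ^ 6 = N ^ 3 := by
    rw [show (6 : ℕ) = 2 * 3 by norm_num, pow_mul, Real.sq_sqrt hN]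
  set d := Real.sqrt N * stepRem ρ σ + 5 * ρ ^ 3 * Real.sqrt N with hd
  have hd0 : 0 ≤ d := by positivity
  set A := Real.sqrt σ + 10 * ρ * Real.sqrt N with hA
  have hA0 : 0 ≤ A := by positivity
  have hA1 : 10 * ρ * Real.sqrt N ≤ A + d := by rw [hA]; linarith
  have hY : (10 * ρ * Real.sqrt N) ^ 2 ≤ (A + d) ^ 2 := pow_le_pow_left₀ (by positivity) hA1 2
  have hP : 0 ≤ 504 * ρ * Real.sqrt N * (10 * Real.sqrt N + 10 * Real.sqrt N) := by positivity
  have hX : Lc * Real.sqrt n * (10 * Real.sqrt N) ^ 2 ≤ Lc * Real.sqrt n * (10 * Real.sqrt N) ^ 2 + m := le_add_of_nonneg_right hm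
  have hS : 0 ≤ m₁ * d * (A + d + A) := by positivity
  calc 100800000 * ρ ^ 3 * N ^ 3 * Real.sqrt n * Lc
      = 504 * ρ * Real.sqrt N * (10 * Real.sqrt N + 10 * Real.sqrt N) * (Lc * Real.sqrt n * (10 * Real.sqrt N) ^ 2) *
          (10 * ρ * Real.sqrt N) ^ 2 := by rw [← hN3]; ring
    _ ≤ 504 * ρ * Real.sqrt N * (10 * Real.sqrt N + 10 * Real.sqrt N) * (Lc * Real.sqrt n * (10 * Real.sqrt N) ^ 2 + m) * (A + d) ^ 2 :=
        mul_le_mul (mul_le_mul_of_nonneg_left hX hP) hY (by positivity) (by positivity)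
    _ ≤ _ := le_add_of_nonneg_right hS

/-- **`N_B ≥ N_free · e^{trialErr} · e^{3|E|·modeZPE((β/2)μ/b')}`** (`β > 0`, `ρ ≥ 0`): the step/chart exponent `(β/2)(η₁+θ) ≥ 0` is dropped and
`√(π/b') ≥ √(π/β)` because `b' = β/(1+ρ²)² ≤ β`. [cite: Luscher1983, §3] -/
theorem riccatiN_ge (L : ℕ) [NeZero L] {β ρ : ℝ} (σ μ : ℝ) (hβ : 0 < β) (hρ : 0 ≤ ρ) :
    (Real.exp (2 * β) * Real.sqrt (π / β) ^ 3 / (2 * π ^ 2)) ^ Fintype.card (Edge 3 L) *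
        Real.exp (trialErr ρ σ (Fintype.card (Plaquette 3 L × Fin 3)) (Fintype.card (Edge 3 L × Fin 3))
          (Real.sqrt ((β / 2) ^ 2 + 2 * (β / 2) * (β / (1 + ρ ^ 2) ^ 2) / μ) / μ)
          (Real.sqrt ((β / 2) ^ 2 + 2 * (β / 2) * (β / (1 + ρ ^ 2) ^ 2) / μ))
          (3 * (β / 2) / μ ^ 2 + 3 * (β / (1 + ρ ^ 2) ^ 2) / μ ^ 3)) *
        Real.exp (((Fintype.card (Edge 3 L) * 3 : ℕ) : ℝ) * modeZPE (β / 2 * μ / (β / (1 + ρ ^ 2) ^ 2))) ≤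
      riccatiN L β ρ σ μ := by
  unfold riccatiN riccatiPref riccatiGauss
  have hX : 1 ≤ Real.exp (β / 2 * (stepErrLo ρ σ (Fintype.card (Plaquette 3 L × Fin 3)) +
      chartErr ρ σ (Fintype.card (Plaquette 3 L × Fin 3)))) := by
    have h1 := stepErrLo_nonneg' σ (Fintype.card (Plaquette 3 L × Fin 3) : ℝ) hρ
    have h2 := chartErr_nonneg' σ (Fintype.card (Plaquette 3 L × Fin 3) : ℝ) hρ
    exact Real.one_le_exp (by positivity)
  have hb : Real.sqrt (π / β) ≤ Real.sqrt (π / (β / (1 + ρ ^ 2) ^ 2)) := by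
    refine Real.sqrt_le_sqrt ?_
    rw [div_div_eq_mul_div]
    refine div_le_div_of_nonneg_right ?_ hβ.le
    have hπ := Real.pi_pos
    nlinarith [sq_nonneg ρ, mul_nonneg hπ.le (sq_nonneg ρ)]
  have hs0 : 0 ≤ Real.sqrt (π / β) := Real.sqrt_nonneg _
  calc (Real.exp (2 * β) * Real.sqrt (π / β) ^ 3 / (2 * π ^ 2)) ^ Fintype.card (Edge 3 L) *
        Real.exp (trialErr ρ σ (Fintype.card (Plaquette 3 L × Fin 3)) (Fintype.card (Edge 3 L × Fin 3))
          (Real.sqrt ((β / 2) ^ 2 + 2 * (β / 2) * (β / (1 + ρ ^ 2) ^ 2) / μ) / μ)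
          (Real.sqrt ((β / 2) ^ 2 + 2 * (β / 2) * (β / (1 + ρ ^ 2) ^ 2) / μ))
          (3 * (β / 2) / μ ^ 2 + 3 * (β / (1 + ρ ^ 2) ^ 2) / μ ^ 3)) *
        Real.exp (((Fintype.card (Edge 3 L) * 3 : ℕ) : ℝ) * modeZPE (β / 2 * μ / (β / (1 + ρ ^ 2) ^ 2)))
      = ((2 * π ^ 2)⁻¹) ^ Fintype.card (Edge 3 L) * Real.exp (2 * β) ^ Fintype.card (Edge 3 L) * 1 *
          Real.exp (trialErr ρ σ (Fintype.card (Plaquette 3 L × Fin 3)) (Fintype.card (Edge 3 L × Fin 3))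
            (Real.sqrt ((β / 2) ^ 2 + 2 * (β / 2) * (β / (1 + ρ ^ 2) ^ 2) / μ) / μ)
            (Real.sqrt ((β / 2) ^ 2 + 2 * (β / 2) * (β / (1 + ρ ^ 2) ^ 2) / μ))
            (3 * (β / 2) / μ ^ 2 + 3 * (β / (1 + ρ ^ 2) ^ 2) / μ ^ 3)) *
          (Real.sqrt (π / β) ^ (Fintype.card (Edge 3 L) * 3) *
            Real.exp (((Fintype.card (Edge 3 L) * 3 : ℕ) : ℝ) * modeZPE (β / 2 * μ / (β / (1 + ρ ^ 2) ^ 2)))) := by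
        rw [div_pow, mul_pow, ← pow_mul, inv_pow]; ring
    _ ≤ _ := by gcongr

/-- **`modeZPE y ≥ √(2y)/4` on `[0, 1/2]`**: `arcosh(1+y) = log(1+y+√(2y+y²)) ≥ log(1+√(2y)) ≥ √(2y)/(1+√(2y)) ≥ √(2y)/2`. [folklore] -/
theorem modeZPE_ge {y : ℝ} (hy : 0 ≤ y) (hy1 : y ≤ 1 / 2) : Real.sqrt (2 * y) / 4 ≤ modeZPE y := by
  unfold modeZPE Real.arcosh
  set s := Real.sqrt (2 * y) with hs
  have hs0 : 0 ≤ s := Real.sqrt_nonneg _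
  have hs1 : s ≤ 1 := by
    rw [hs]
    calc Real.sqrt (2 * y) ≤ Real.sqrt 1 := Real.sqrt_le_sqrt (by linarith)
      _ = 1 := Real.sqrt_one
  have hroot : s ≤ Real.sqrt ((1 + y) ^ 2 - 1) := Real.sqrt_le_sqrt (by nlinarith)
  have hlog : 1 - (1 + s)⁻¹ ≤ Real.log (1 + y + Real.sqrt ((1 + y) ^ 2 - 1)) :=
    calc 1 - (1 + s)⁻¹ ≤ Real.log (1 + s) := Real.one_sub_inv_le_log_of_pos (by linarith)
      _ ≤ Real.log (1 + y + Real.sqrt ((1 + y) ^ 2 - 1)) := Real.log_le_log (by linarith) (by linarith)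
  have hkey : s / 2 ≤ 1 - (1 + s)⁻¹ := by
    have e : 1 - (1 + s)⁻¹ = s / (1 + s) := by field_simp; ring
    rw [e, div_le_div_iff₀ (by norm_num) (by linarith)]
    nlinarith
  linarith

/-- **`Z₀(1) = modeZPE m`**: on the `1³` torus the only momentum is `0` and `lap1 1 0 0 = 0`, so `toronZPE 1 κ m 0 = modeZPE m`;
in particular the massless zero-twist zero-point energy of `ValleyFloorAt 1` vanishes. [folklore] -/
theorem toronZPE_one (κ m : ℝ) : toronZPE 1 κ m 0 = modeZPE m := by
  unfold toronZPE lap3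
  have h1 : ∀ (j : Fin 3 → Fin 1) (k : Fin 3), lap1 1 ((0 : Fin 3 → ℝ) k) (j k) = 0 := fun j k => by
    rw [Pi.zero_apply, Subsingleton.elim (j k) 0]; exact lap1_zero_zero 1
  simp only [h1, Finset.sum_const_zero, mul_zero, add_zero, Finset.sum_const, Finset.card_univ, Fintype.card_pi,
    Finset.prod_const, Fintype.card_fin, one_pow, one_smul]

/-- `toronZPE 1 κ 0 0 = 0`. [folklore] -/
theorem toronZPE_one_zero (κ : ℝ) : toronZPE 1 κ 0 0 = 0 := by rw [toronZPE_one, modeZPE_zero]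

/-! ## §2 ★ FLOOR(N_B) is false for `3r < 1 + 3m` (every `L`, every `q`) -/

/-- `(1 : ℝ) ≤ #(Plaquette 3 L × Fin 3)` and `1 ≤ #(Edge 3 L × Fin 3)` (`L ≥ 1`). [folklore] -/
theorem one_le_cards (L : ℕ) [NeZero L] :
    (1 : ℝ) ≤ (Fintype.card (Plaquette 3 L × Fin 3) : ℝ) ∧ (1 : ℝ) ≤ (Fintype.card (Edge 3 L × Fin 3) : ℝ) ∧
      (3 : ℝ) ≤ ((Fintype.card (Edge 3 L) * 3 : ℕ) : ℝ) := by
  have i1 : Nonempty (Plaquette 3 L × Fin 3) := ⟨((fun _ => 0, ⟨(0, 1), by decide⟩), 0)⟩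
  have i2 : Nonempty (Edge 3 L × Fin 3) := ⟨((fun _ => 0, 0), 0)⟩
  have i3 : Nonempty (Edge 3 L) := ⟨(fun _ => 0, 0)⟩
  refine ⟨by exact_mod_cast Fintype.card_pos, by exact_mod_cast Fintype.card_pos, ?_⟩
  have h3 : 1 ≤ Fintype.card (Edge 3 L) := Fintype.card_pos
  push_cast
  have : (1 : ℝ) ≤ (Fintype.card (Edge 3 L) : ℝ) := by exact_mod_cast h3
  linarith

/-- **The exponent identity** `ρ³·(β/μ³) = β^{1+3m−3r}` at `ρ = β^{−r}`, `μ = β^{−m}` (`β > 0`). [folklore] -/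
theorem rpow_ledger {β : ℝ} (r m : ℝ) (hβ : 0 < β) :
    (β ^ (-r)) ^ 3 * (β / (β ^ (-m)) ^ 3) = β ^ (1 + 3 * m - 3 * r) := by
  have e1 : (β ^ (-r)) ^ 3 = β ^ (-(3 * r)) := by
    rw [← Real.rpow_natCast, ← Real.rpow_mul hβ.le]; congr 1; push_cast; ring
  have e2 : (β ^ (-m)) ^ 3 = β ^ (-(3 * m)) := by
    rw [← Real.rpow_natCast, ← Real.rpow_mul hβ.le]; congr 1; push_cast; ring
  rw [e1, e2, div_eq_mul_inv, ← Real.rpow_neg hβ.le, neg_neg,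
    show (1 + 3 * m - 3 * r) = -(3 * r) + (1 + 3 * m) by ring, Real.rpow_add hβ, Real.rpow_add hβ, Real.rpow_one]

/-- **FLOOR(ε) and the ceiling bound the loaded exponents**: if `ValleyFloorAt L δ (1/2) N_B` holds with lane B's `N_B` at scales
`ρ(β) ≥ 0`, then for every `ε > 0`, eventually `trialErr(…) + 3|E|·modeZPE((β/2)μ/b') ≤ 6Z₀(L) + εδ(β)`. [cite: Luscher1983, §3] -/
theorem loaded_exponents_le_of_floor (L : ℕ) [NeZero L] {δ ρ σ μ : ℝ → ℝ} (hρ : ∀ β, 0 ≤ ρ β)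
    (hF : ValleyFloorAt L δ (1 / 2) (fun β => riccatiN L β (ρ β) (σ β) (μ β))) :
    ∀ ε : ℝ, 0 < ε → ∃ β0 : ℝ, ∀ β : ℝ, β0 ≤ β →
      trialErr (ρ β) (σ β) (Fintype.card (Plaquette 3 L × Fin 3)) (Fintype.card (Edge 3 L × Fin 3))
          (Real.sqrt ((β / 2) ^ 2 + 2 * (β / 2) * (β / (1 + ρ β ^ 2) ^ 2) / μ β) / μ β)
          (Real.sqrt ((β / 2) ^ 2 + 2 * (β / 2) * (β / (1 + ρ β ^ 2) ^ 2) / μ β))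
          (3 * (β / 2) / μ β ^ 2 + 3 * (β / (1 + ρ β ^ 2) ^ 2) / μ β ^ 3) +
        ((Fintype.card (Edge 3 L) * 3 : ℕ) : ℝ) * modeZPE (β / 2 * μ β / (β / (1 + ρ β ^ 2) ^ 2)) ≤
      6 * toronZPE L (1 / 2) 0 0 + ε * δ β := by
  intro ε hε
  obtain ⟨β0, hβ0⟩ := hF ε hε
  refine ⟨max β0 1, fun β hβ => ?_⟩
  have hβ1 : 1 ≤ β := (le_max_right _ _).trans hβ
  have hβpos : 0 < β := by linarith
  have hFβ := hβ0 β ((le_max_left _ _).trans hβ)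
  simp only at hFβ
  have hlow := riccatiN_ge L (σ β) (μ β) hβpos (hρ β)
  have hceil := levelValue_zero_le_gauss L hβpos
  set Nf := (Real.exp (2 * β) * Real.sqrt (π / β) ^ 3 / (2 * π ^ 2)) ^ Fintype.card (Edge 3 L) with hNf
  have hNf0 : 0 < Nf := by positivity
  set T := trialErr (ρ β) (σ β) (Fintype.card (Plaquette 3 L × Fin 3)) (Fintype.card (Edge 3 L × Fin 3))
          (Real.sqrt ((β / 2) ^ 2 + 2 * (β / 2) * (β / (1 + ρ β ^ 2) ^ 2) / μ β) / μ β)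
          (Real.sqrt ((β / 2) ^ 2 + 2 * (β / 2) * (β / (1 + ρ β ^ 2) ^ 2) / μ β))
          (3 * (β / 2) / μ β ^ 2 + 3 * (β / (1 + ρ β ^ 2) ^ 2) / μ β ^ 3) with hT
  set Zn := ((Fintype.card (Edge 3 L) * 3 : ℕ) : ℝ) * modeZPE (β / 2 * μ β / (β / (1 + ρ β ^ 2) ^ 2)) with hZn
  set Z := toronZPE L (1 / 2) 0 0 with hZ
  have hchain : Nf * Real.exp T * Real.exp Zn * Real.exp (-(6 * Z)) * Real.exp (-(ε * δ β)) ≤ Nf :=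
    calc Nf * Real.exp T * Real.exp Zn * Real.exp (-(6 * Z)) * Real.exp (-(ε * δ β))
        ≤ riccatiN L β (ρ β) (σ β) (μ β) * Real.exp (-(6 * Z)) * Real.exp (-(ε * δ β)) :=
          mul_le_mul_of_nonneg_right (mul_le_mul_of_nonneg_right hlow (Real.exp_pos _).le) (Real.exp_pos _).le
      _ ≤ levelValue su2Rep L β 0 := hFβ
      _ ≤ Nf := hceil
  have h2 : Nf * (Real.exp T * Real.exp Zn * Real.exp (-(6 * Z)) * Real.exp (-(ε * δ β))) ≤ Nf * 1 := by
    rw [mul_one]; exact le_of_eq_of_le (by ring) hchain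
  have h3 := le_of_mul_le_mul_left h2 hNf0
  rw [← Real.exp_add, ← Real.exp_add, ← Real.exp_add, Real.exp_le_one_iff] at h3
  linarith

/-- ★ **FLOOR(N_B) IS FALSE FOR `3r < 1 + 3m`** (every `L ≥ 1`, every `q`, every real `m`; `p, r ≥ 0`): the k = 0 floor clause
`ValleyFloorAt L (β^{−p}) (1/2) N_B` with lane B's normalisation at the scales `ρ = β^{−r}`, `σ = 2β^{−q}`, `μ = β^{−m}` fails, because the ceiling
`λ₀ ≤ N_free` and FLOOR(ε = 1) force `trialErr ≤ 6Z₀(L) + 1` eventually, whereas the Lipschitz term gives `trialErr ≥ β^{1+3m−3r} → ∞`.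
Hence the hypothesis `hF` of `coarseNoIntruderAt_of_floor_pow` is unsatisfiable on `3r ≤ 1 + 3m` ∩ {its typed constraints}:
lane A's ledger constraint `r > 1/3 + m` is NECESSARY. [cite: Luscher1983, §3] -/
theorem valleyFloorAt_riccatiN_false (L : ℕ) [NeZero L] {p q r m : ℝ} (hp : 0 ≤ p) (hr : 0 ≤ r) (h : 3 * r < 1 + 3 * m) :
    ¬ ValleyFloorAt L (powScale p) (1 / 2) (fun β => riccatiN L β (powScale r β) (2 * powScale q β) (powScale m β)) := by
  intro hF
  obtain ⟨β0, hβ0⟩ := loaded_exponents_le_of_floor L (ρ := powScale r) (σ := fun β => 2 * powScale q β) (μ := powScale m)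
    (fun β => (powScale_pos r β).le) hF 1 one_pos
  set Z := toronZPE L (1 / 2) 0 0 with hZ
  set a := 1 + 3 * m - 3 * r with ha
  have ha0 : 0 < a := by rw [ha]; linarith
  obtain ⟨β, hβ1, hβa⟩ : ∃ β : ℝ, max β0 1 ≤ β ∧ 6 * Z + 2 ≤ β ^ a := by
    obtain ⟨β, hβ⟩ := (((tendsto_rpow_atTop ha0).eventually_ge_atTop (6 * Z + 2)).and (eventually_ge_atTop (max β0 1))).exists
    exact ⟨β, hβ.2, hβ.1⟩
  have hβ1' : 1 ≤ β := (le_max_right _ _).trans hβ1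
  have hβpos : 0 < β := by linarith
  have hE := hβ0 β ((le_max_left _ _).trans hβ1)
  simp only [powScale_eq hβ1', one_mul] at hE
  obtain ⟨hN1, hn1, -⟩ := one_le_cards L
  set N : ℝ := (Fintype.card (Plaquette 3 L × Fin 3) : ℝ) with hN
  set n : ℝ := (Fintype.card (Edge 3 L × Fin 3) : ℝ) with hn
  set ρ := β ^ (-r) with hρ
  set μ := β ^ (-m) with hμ
  have hρ0 : 0 ≤ ρ := (Real.rpow_pos_of_pos hβpos _).le
  have hρ1 : ρ ≤ 1 := Real.rpow_le_one_of_one_le_of_nonpos hβ1' (by linarith)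
  have hμ0 : 0 < μ := Real.rpow_pos_of_pos hβpos _
  have hp1 : β ^ (-p) ≤ 1 := Real.rpow_le_one_of_one_le_of_nonpos hβ1' (by linarith)
  -- the loaded exponents
  have hZn : 0 ≤ ((Fintype.card (Edge 3 L) * 3 : ℕ) : ℝ) * modeZPE (β / 2 * μ / (β / (1 + ρ ^ 2) ^ 2)) :=
    mul_nonneg (Nat.cast_nonneg _) (modeZPE_nonneg (by positivity))
  have hT := trialErr_ge (σ := 2 * β ^ (-q)) (n := n)
    (m := Real.sqrt ((β / 2) ^ 2 + 2 * (β / 2) * (β / (1 + ρ ^ 2) ^ 2) / μ) / μ)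
    (m₁ := Real.sqrt ((β / 2) ^ 2 + 2 * (β / 2) * (β / (1 + ρ ^ 2) ^ 2) / μ))
    (Lc := 3 * (β / 2) / μ ^ 2 + 3 * (β / (1 + ρ ^ 2) ^ 2) / μ ^ 3) hρ0 (by positivity : (0 : ℝ) ≤ N) (by positivity)
    (Real.sqrt_nonneg _) (by positivity)
  -- `Lc ≥ (3/4)·β/μ³` and the exponent identity
  have hb' : β / 4 ≤ β / (1 + ρ ^ 2) ^ 2 := by
    rw [div_le_div_iff₀ (by norm_num) (by positivity)]
    have hρ2 : ρ ^ 2 ≤ 1 := by rw [sq]; exact mul_le_one₀ hρ1 hρ0 hρ1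
    have h4 : (1 + ρ ^ 2) ^ 2 ≤ (1 + 1) ^ 2 := pow_le_pow_left₀ (by positivity) (by linarith) 2
    nlinarith
  have hLc : β / μ ^ 3 ≤ 4 / 3 * (3 * (β / 2) / μ ^ 2 + 3 * (β / (1 + ρ ^ 2) ^ 2) / μ ^ 3) := by
    have h1 : 0 ≤ 3 * (β / 2) / μ ^ 2 := by positivity
    have h2 : β / μ ^ 3 ≤ 4 / 3 * (3 * (β / (1 + ρ ^ 2) ^ 2) / μ ^ 3) := by
      rw [show 4 / 3 * (3 * (β / (1 + ρ ^ 2) ^ 2) / μ ^ 3) = 4 * (β / (1 + ρ ^ 2) ^ 2) / μ ^ 3 by ring]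
      exact div_le_div_of_nonneg_right (by linarith) (by positivity)
    nlinarith
  have hid : ρ ^ 3 * (β / μ ^ 3) = β ^ a := by rw [hρ, hμ, ha]; exact rpow_ledger r m hβpos
  have hN3 : 1 ≤ N ^ 3 := one_le_pow₀ hN1
  have hsn : 1 ≤ Real.sqrt n := Real.one_le_sqrt.mpr hn1
  have hmain : β ^ a ≤ 100800000 * ρ ^ 3 * N ^ 3 * Real.sqrt n * (3 * (β / 2) / μ ^ 2 + 3 * (β / (1 + ρ ^ 2) ^ 2) / μ ^ 3) := by
    have hL0 : 0 ≤ 3 * (β / 2) / μ ^ 2 + 3 * (β / (1 + ρ ^ 2) ^ 2) / μ ^ 3 := by positivity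
    calc β ^ a = ρ ^ 3 * (β / μ ^ 3) := hid.symm
      _ ≤ ρ ^ 3 * (4 / 3 * (3 * (β / 2) / μ ^ 2 + 3 * (β / (1 + ρ ^ 2) ^ 2) / μ ^ 3)) := mul_le_mul_of_nonneg_left hLc (by positivity)
      _ = 4 / 3 * ρ ^ 3 * 1 * 1 * (3 * (β / 2) / μ ^ 2 + 3 * (β / (1 + ρ ^ 2) ^ 2) / μ ^ 3) := by ring
      _ ≤ 100800000 * ρ ^ 3 * N ^ 3 * Real.sqrt n * (3 * (β / 2) / μ ^ 2 + 3 * (β / (1 + ρ ^ 2) ^ 2) / μ ^ 3) := by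
          gcongr; norm_num
  linarith

/-- **Vacuity witness**: the exponents `(p, q, r, m) = (1/40, 0.85, 0.35, 0.055)` satisfy every typed hypothesis of `coarseNoIntruderAt_of_floor_pow`
(`0 < p < 1/3`, `4p < q < 8/9`, `0 < r`, `2r < 1`, `0 < m`, `2r < q − m/2`) and yet its `hF` is refuted (`3r = 1.05 < 1.165`). -/
example (L : ℕ) [NeZero L] :
    ((0 : ℝ) < 1 / 40 ∧ (1 / 40 : ℝ) < 1 / 3 ∧ 4 * (1 / 40 : ℝ) < 0.85 ∧ (0.85 : ℝ) < 8 / 9 ∧ (0 : ℝ) < 0.35 ∧ 2 * (0.35 : ℝ) < 1 ∧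
        (0 : ℝ) < 0.055 ∧ 2 * (0.35 : ℝ) < 0.85 - 0.055 / 2) ∧
      ¬ ValleyFloorAt L (powScale (1 / 40)) (1 / 2)
        (fun β => riccatiN L β (powScale 0.35 β) (2 * powScale 0.85 β) (powScale 0.055 β)) :=
  ⟨by norm_num, valleyFloorAt_riccatiN_false L (by norm_num) (by norm_num) (by norm_num)⟩

/-! ## §3 ★ At `L = 1` the free ceiling sees every loaded exponent: `m > 2p` and `3r > 1 + 3m + p` are necessary -/

/-- ★ **FLOOR(N_B) AT `L = 1` IS FALSE UNLESS `m > 2p` AND `3r > 1 + 3m + p`** (`r, m ≥ 0`, any real `p`): on the `1³` torus `Z₀ = 0`, so FLOOR(ε = 1) and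
the ceiling force `trialErr + 9·modeZPE(μ(1+ρ²)²/2) ≤ β^{−p}` eventually; but `9·modeZPE(…) ≥ 9·modeZPE(β^{−m}/2) ≥ (9/4)β^{−m/2} > β^{−p}` when
`m ≤ 2p`, and `trialErr ≥ β^{1+3m−3r} ≥ β^{−p}` (with `9·modeZPE > 0`) when `3r ≤ 1 + 3m + p`. [cite: Luscher1983, §3] -/
theorem valleyFloorAt_riccatiN_one_false {p q r m : ℝ} (hr : 0 ≤ r) (hm : 0 ≤ m) (h : m ≤ 2 * p ∨ 3 * r ≤ 1 + 3 * m + p) :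
    ¬ ValleyFloorAt 1 (powScale p) (1 / 2) (fun β => riccatiN 1 β (powScale r β) (2 * powScale q β) (powScale m β)) := by
  intro hF
  obtain ⟨β0, hβ0⟩ := loaded_exponents_le_of_floor 1 (ρ := powScale r) (σ := fun β => 2 * powScale q β) (μ := powScale m)
    (fun β => (powScale_pos r β).le) hF 1 one_pos
  set β := max β0 1 with hβdef
  have hβ1' : 1 ≤ β := le_max_right _ _
  have hβpos : 0 < β := by linarith
  have hE := hβ0 β (le_max_left _ _)
  simp only [powScale_eq hβ1', one_mul, toronZPE_one_zero, mul_zero, zero_add] at hE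
  obtain ⟨hN1, hn1, h3⟩ := one_le_cards 1
  set N : ℝ := (Fintype.card (Plaquette 3 1 × Fin 3) : ℝ) with hN
  set n : ℝ := (Fintype.card (Edge 3 1 × Fin 3) : ℝ) with hn
  set ρ := β ^ (-r) with hρ
  set μ := β ^ (-m) with hμ
  have hρ0 : 0 ≤ ρ := (Real.rpow_pos_of_pos hβpos _).le
  have hρ1 : ρ ≤ 1 := Real.rpow_le_one_of_one_le_of_nonpos hβ1' (by linarith)
  have hμ0 : 0 < μ := Real.rpow_pos_of_pos hβpos _
  have hμ1 : μ ≤ 1 := Real.rpow_le_one_of_one_le_of_nonpos hβ1' (by linarith)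
  have hpp : 0 < β ^ (-p) := Real.rpow_pos_of_pos hβpos _
  -- the ZPE exponent: `modeZPE((β/2)μ/b') ≥ modeZPE(μ/2) ≥ √μ/4 = β^{−m/2}/4`
  have hy : μ / 2 ≤ β / 2 * μ / (β / (1 + ρ ^ 2) ^ 2) := by
    rw [show β / 2 * μ / (β / (1 + ρ ^ 2) ^ 2) = μ / 2 * (1 + ρ ^ 2) ^ 2 by field_simp]
    have : 1 ≤ (1 + ρ ^ 2) ^ 2 := by nlinarith [sq_nonneg ρ]
    nlinarith [hμ0.le]
  have hZ1 : Real.sqrt μ / 4 ≤ modeZPE (β / 2 * μ / (β / (1 + ρ ^ 2) ^ 2)) := by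
    have h1 := modeZPE_ge (y := μ / 2) (by positivity) (by linarith)
    rw [show 2 * (μ / 2) = μ by ring] at h1
    exact h1.trans (modeZPE_le_modeZPE (by positivity) hy)
  have hsμ : Real.sqrt μ = β ^ (-(m / 2)) := by
    rw [hμ, Real.sqrt_eq_rpow, ← Real.rpow_mul hβpos.le]; congr 1; ring
  have hZn : 9 * (β ^ (-(m / 2)) / 4) ≤ ((Fintype.card (Edge 3 1) * 3 : ℕ) : ℝ) * modeZPE (β / 2 * μ / (β / (1 + ρ ^ 2) ^ 2)) := by
    rw [← hsμ]
    have h0 : 0 ≤ Real.sqrt μ / 4 := by positivity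
    have h9 : (9 : ℝ) ≤ ((Fintype.card (Edge 3 1) * 3 : ℕ) : ℝ) := by
      rw [Nat.cast_mul, Fintype.card_prod, Fintype.card_pi]; norm_num
    calc 9 * (Real.sqrt μ / 4) ≤ ((Fintype.card (Edge 3 1) * 3 : ℕ) : ℝ) * (Real.sqrt μ / 4) := mul_le_mul_of_nonneg_right h9 h0
      _ ≤ _ := mul_le_mul_of_nonneg_left hZ1 (by positivity)
  -- the trial exponent: `trialErr ≥ β^{1+3m−3r}`
  have hT := trialErr_ge (σ := 2 * β ^ (-q)) (n := n)
    (m := Real.sqrt ((β / 2) ^ 2 + 2 * (β / 2) * (β / (1 + ρ ^ 2) ^ 2) / μ) / μ)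
    (m₁ := Real.sqrt ((β / 2) ^ 2 + 2 * (β / 2) * (β / (1 + ρ ^ 2) ^ 2) / μ))
    (Lc := 3 * (β / 2) / μ ^ 2 + 3 * (β / (1 + ρ ^ 2) ^ 2) / μ ^ 3) hρ0 (by positivity : (0 : ℝ) ≤ N) (by positivity)
    (Real.sqrt_nonneg _) (by positivity)
  have hb' : β / 4 ≤ β / (1 + ρ ^ 2) ^ 2 := by
    rw [div_le_div_iff₀ (by norm_num) (by positivity)]
    have hρ2 : ρ ^ 2 ≤ 1 := by rw [sq]; exact mul_le_one₀ hρ1 hρ0 hρ1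
    have h4 : (1 + ρ ^ 2) ^ 2 ≤ (1 + 1) ^ 2 := pow_le_pow_left₀ (by positivity) (by linarith) 2
    nlinarith
  have hLc : β / μ ^ 3 ≤ 4 / 3 * (3 * (β / 2) / μ ^ 2 + 3 * (β / (1 + ρ ^ 2) ^ 2) / μ ^ 3) := by
    have h1 : 0 ≤ 3 * (β / 2) / μ ^ 2 := by positivity
    have h2 : β / μ ^ 3 ≤ 4 / 3 * (3 * (β / (1 + ρ ^ 2) ^ 2) / μ ^ 3) := by
      rw [show 4 / 3 * (3 * (β / (1 + ρ ^ 2) ^ 2) / μ ^ 3) = 4 * (β / (1 + ρ ^ 2) ^ 2) / μ ^ 3 by ring]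
      exact div_le_div_of_nonneg_right (by linarith) (by positivity)
    nlinarith
  have hid : ρ ^ 3 * (β / μ ^ 3) = β ^ (1 + 3 * m - 3 * r) := by rw [hρ, hμ]; exact rpow_ledger r m hβpos
  have hN3 : 1 ≤ N ^ 3 := one_le_pow₀ hN1
  have hsn : 1 ≤ Real.sqrt n := Real.one_le_sqrt.mpr hn1
  have hmain : β ^ (1 + 3 * m - 3 * r) ≤
      100800000 * ρ ^ 3 * N ^ 3 * Real.sqrt n * (3 * (β / 2) / μ ^ 2 + 3 * (β / (1 + ρ ^ 2) ^ 2) / μ ^ 3) := by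
    have hL0 : 0 ≤ 3 * (β / 2) / μ ^ 2 + 3 * (β / (1 + ρ ^ 2) ^ 2) / μ ^ 3 := by positivity
    calc β ^ (1 + 3 * m - 3 * r) = ρ ^ 3 * (β / μ ^ 3) := hid.symm
      _ ≤ ρ ^ 3 * (4 / 3 * (3 * (β / 2) / μ ^ 2 + 3 * (β / (1 + ρ ^ 2) ^ 2) / μ ^ 3)) := mul_le_mul_of_nonneg_left hLc (by positivity)
      _ = 4 / 3 * ρ ^ 3 * 1 * 1 * (3 * (β / 2) / μ ^ 2 + 3 * (β / (1 + ρ ^ 2) ^ 2) / μ ^ 3) := by ring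
      _ ≤ 100800000 * ρ ^ 3 * N ^ 3 * Real.sqrt n * (3 * (β / 2) / μ ^ 2 + 3 * (β / (1 + ρ ^ 2) ^ 2) / μ ^ 3) := by
          gcongr; norm_num
  rcases h with hmp | hrp
  · -- `m ≤ 2p`: `β^{−m/2} ≥ β^{−p}`
    have h1 : β ^ (-p) ≤ β ^ (-(m / 2)) := Real.rpow_le_rpow_of_exponent_le hβ1' (by linarith)
    have hT0 : 0 ≤ 100800000 * ρ ^ 3 * N ^ 3 * Real.sqrt n * (3 * (β / 2) / μ ^ 2 + 3 * (β / (1 + ρ ^ 2) ^ 2) / μ ^ 3) := by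
      positivity
    linarith
  · -- `3r ≤ 1 + 3m + p`: `β^{1+3m−3r} ≥ β^{−p}`
    have h1 : β ^ (-p) ≤ β ^ (1 + 3 * m - 3 * r) := Real.rpow_le_rpow_of_exponent_le hβ1' (by linarith)
    have h2 : 0 < β ^ (-(m / 2)) := Real.rpow_pos_of_pos hβpos _
    linarith

/-- At lane A's `p = 1/40`: the `L = 1` FLOOR is refuted at `m = 0.05 = 2p` (any `r, q`) and at `(r, m) = (0.36, 0.055)` (`3r = 1.08 ≤ 1.19`);
the point of record `(r, m) = (0.41, 0.055)` passes both necessary conditions (`0.055 > 0.05`, `1.23 > 1.19`). -/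
example (q r : ℝ) (hr : 0 ≤ r) :
    ¬ ValleyFloorAt 1 (powScale (1 / 40)) (1 / 2) (fun β => riccatiN 1 β (powScale r β) (2 * powScale q β) (powScale 0.05 β)) ∧
      ¬ ValleyFloorAt 1 (powScale (1 / 40)) (1 / 2) (fun β => riccatiN 1 β (powScale 0.36 β) (2 * powScale q β) (powScale 0.055 β)) ∧
      ((2 : ℝ) * (1 / 40) < 0.055 ∧ (1 : ℝ) + 3 * 0.055 + 1 / 40 < 3 * 0.41) :=
  ⟨valleyFloorAt_riccatiN_one_false hr (by norm_num) (Or.inl (by norm_num)),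
    valleyFloorAt_riccatiN_one_false (by norm_num) (by norm_num) (Or.inr (by norm_num)), by norm_num⟩

/-! ## §4 The typed shadow of the exponent ledger -/

/-- **Ledger window**: lane A's typed constraints `2r < 1`, `2r < q − m/2` together with the necessary `1 + 3m < 3r` of
`valleyFloorAt_riccatiN_false` force `q > 2/3 + 5m/2`, `r > 1/3`, `m < 1/6`; with the `L = 1` condition `2p < m` also `q > 2/3 + 5p`. [folklore] -/
theorem floor_ledger_window {p q r m : ℝ} (hr1 : 2 * r < 1) (hrq : 2 * r < q - m / 2) (hN : 1 + 3 * m < 3 * r) :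
    2 / 3 + 5 * m / 2 < q ∧ 1 / 3 + m < r ∧ m < 1 / 6 ∧ (2 * p < m → 2 / 3 + 5 * p < q) :=
  ⟨by linarith, by linarith, by linarith, fun hpm => by linarith⟩

end Summit.QuantumFields.YangMills.Theorems.TwistedTraceScaling.Negative.R13

end
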